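import Literature.NumberTheory.Automorphic.Liu2021.ThetaLiftFromLineMeets
import Literature.NumberTheory.GelbartRogawski1991.DoubledBlockDiagEmbedding
import Literature.NumberTheory.GelbartRogawski1991.DoubledUnitaryGlobalSplittingData

/-!
# K2Lit — the theta kernel and the theta integral of the DOUBLED hermitian space against a hermitian line (DEFS leaf D8)

Definitions only (Track B, build stream 29, item of record hLiu418 = stmt-HodgeConjecture-24832; planner
`hodgecm-mathlib-K2Liu-plan` g0, 2026-09-03).  The unit U6 «FIRST TERM» of the s5 seam (`Cruxes/HLiu418/Lines/K2_Liu_LocalSeam_s23.md` §6,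
sockets #42 `EisensteinResidueIsThetaIntegral`, #44 `UndoubleLineThetaIntegral`, #45 `PureTensorSeparation`, #47) needs the theta kernel of the
dual pair `U(𝔻) × U(⟨a'⟩)`, `𝔻 = 𝕍 ⊕ (−𝕍)` the DOUBLED space of ★ `GRConstruction.HA` (`H(𝔸) = U(J^𝔻)(𝔸_{L⁺}) ≤ GL_{n+n}(𝔸_L)`), and the theta
INTEGRAL `I(h; Φ) = ∫_{[U(⟨a'⟩)]} θ_Φ(h, w) dw` whose value at `h = ι(g₁, g₂)` undoubles into the see-saw pairing of s5.

D8 REUSE VERDICT (DEPMAP v2.1, 22:34Z): the doubled Gram matrix is PROVABLY diagonal — ★ `GRConstruction.gramD_eq_diagonal`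
(`T^𝔻 = diag((t₀ ⊕ (−t₀)) ∘ e₂⁻¹)`, `t₀ = cmGramEntry`) — so the letter's ★ line-theta constructor ★ `Liu2021.lineThetaKernelDatum L (n + n) e₁ dD …`
(any rank `N`, here `N := n + n`, diagonal coefficients `dD`) applies VERBATIM after transporting `H(𝔸)` along the equality of forms
`J^𝔻 = diagonal dD` (`MulEquiv.subgroupCongr`, the pattern of ★ `GRConstruction.inlGRat`).  This leaf is therefore THIN:
* `dD e dV hdV dW hdW : Fin (n + n) → L` — the diagonal coefficients `(t₀ ⊕ (−t₀)) ∘ e₂⁻¹` of `J^𝔻`, with `dD_conj` (real) and `dD_ne_zero`;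
* `hermD_eq_diagonal_dD : hermD = Matrix.diagonal dD`; `adelic_hermD_eq` (the two ★ `UnitaryGroup.adelic` subgroups of `GL_{n+n}(𝔸_L)` coincide);
* `toDiagA : HA ≃* U(diagonal dD)(𝔸)` (identity on matrices: `coe_toDiagA`), `continuous_toDiagA`, `continuous_toDiagA_symm`;
* `doubledLineThetaLift e₁ lam hlam a' hρ μW Φ f : HA → ℂ`, `h ↦ ∫ f(q)·θ_Φ((toDiagA h)⁻¹Γ, q) dμW(q)` with the KERNEL ★ `(lineThetaKernelDatum L (n+n) e₁ dD …
  lam hlam a' hρ).thetaKer Φ` (a pointwise Bochner integral: ★ `thetaLiftFun` is typed under `[CompactSpace [U(𝔻)]]`, false for the quasi-split `U(𝔻)`),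
  and the THETA INTEGRAL `doubledLineThetaIntegral … μW Φ := doubledLineThetaLift … μW Φ 1` (weight `f = 1`: `I(h;Φ) = ∫_{[U(⟨a'⟩)]} θ_Φ(h,w) dμW(w)`).
Nothing is asserted about Siegel–Weil: the first-term identity (#42), undoubling (#44) and pure-tensor separation (#45) are SOCKETS typed over
these names in U6 ED. 3.  The Lean development is original; the citations locate the objects.
References: [Liu2021] Y. Liu, *Fourier–Jacobi cycles and arithmetic relative trace formula*, Camb. J. Math. 9 (2021), App. B (B.7), Prop. B.8, p. 104;
[KudlaRallis1994] S. Kudla, S. Rallis, *A regularized Siegel–Weil formula: the first term identity*, Ann. of Math. 140 (1994) §§1, 6;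
[GelbartRogawski1991] §3.1 Prop. 3.1.1 p. 455; [HarrisKudlaSweet1996] §1 (1.9).
-/

noncomputable section

open NumberField MeasureTheory IsDedekindDomain
open scoped Matrix ComplexOrder

namespace Literature.NumberTheory.K2Lit.DoubledLineTheta

open Literature.NumberTheory.Automorphic Literature.NumberTheory.Automorphic.UnitaryGroup
open Literature.NumberTheory.Automorphic.IdeleClassGroup
open Literature.NumberTheory.Automorphic.Liu2021
open Literature.NumberTheory.Automorphic.Liu2021.Def411WeilCarriers
open Literature.NumberTheory.Automorphic.Liu2021.Def411WeilCarriersDoubling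
open Literature.NumberTheory.GelbartRogawski1991 Literature.NumberTheory.GelbartRogawski1991.UnitaryDualPair
open Literature.NumberTheory.GelbartRogawski1991.GRConstruction
open Literature.NumberTheory.Weil1964
open Literature.RepresentationTheory.Liu2021

variable (L : Type) [Field L] [NumberField L] [IsCMField L]
variable {N M n : ℕ} (e : Fin N × Fin M ≃ Fin n)
  (dV : Fin N → L) (hdV : ∀ i, IsCMField.complexConj L (dV i) = dV i)
  (dW : Fin M → L) (hdW : ∀ i, IsCMField.complexConj L (dW i) = dW i)

/-! ## 1. The diagonal coefficients of the doubled form -/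

/-- **`dD = (t₀ ⊕ (−t₀)) ∘ e₂⁻¹ : Fin (n+n) → L`**, `t₀ k = dV (e⁻¹ k)₁ · dW (e⁻¹ k)₂` (★ `cmGramEntry`): the diagonal coefficients of the doubled
hermitian Gram matrix `J^𝔻 = J ⊕ (−J)` in the tree's enumeration `e₂ = finSumFinEquiv`. [cite: GelbartRogawski1991, §3.1 Prop. 3.1.1 p. 455] -/
def dD (k : Fin (n + n)) : L :=
  ((Sum.elim (cmGramEntry L e dV hdV dW hdW) (-cmGramEntry L e dV hdV dW hdW) ((finSumFinEquiv (m := n) (n := n)).symm k) :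
      ↥(maximalRealSubfield L)) : L)

/-- the coefficients `dD` are real (`c(dD k) = dD k`): they are (± products of) elements of `L⁺`. [cite: GelbartRogawski1991, §3.1 Prop. 3.1.1 p. 455] -/
theorem dD_conj (k : Fin (n + n)) : IsCMField.complexConj L (dD L e dV hdV dW hdW k) = dD L e dV hdV dW hdW k :=
  (IsCMField.complexConj_eq_self_iff (K := L) _).2 (Subtype.coe_prop _)

/-- the coefficients `dD` are non-zero when no `dV i`, `dW j` vanishes. [cite: GelbartRogawski1991, §3.1 Prop. 3.1.1 p. 455] -/
theorem dD_ne_zero (hdV0 : ∀ i, dV i ≠ 0) (hdW0 : ∀ i, dW i ≠ 0) (k : Fin (n + n)) : dD L e dV hdV dW hdW k ≠ 0 := by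
  have h0 : ∀ j, cmGramEntry L e dV hdV dW hdW j ≠ 0 := cmGramEntry_ne_zero L e dV hdV dW hdW hdV0 hdW0
  unfold dD
  generalize (finSumFinEquiv (m := n) (n := n)).symm k = s
  rcases s with j | j
  · simp only [Sum.elim_inl]
    exact fun h => h0 j (Subtype.ext h)
  · simp only [Sum.elim_inr, Pi.neg_apply, NegMemClass.coe_neg, ne_eq, neg_eq_zero]
    exact fun h => h0 j (Subtype.ext h)

/-- **`J^𝔻 = diagonal dD`** (★ `gramD_eq_diagonal` mapped to `L`). [cite: GelbartRogawski1991, §3.1 Prop. 3.1.1 p. 455] [cite: HarrisKudlaSweet1996, §1 (1.9)] -/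
theorem hermD_eq_diagonal_dD : hermD L e dV hdV dW hdW = Matrix.diagonal (dD L e dV hdV dW hdW) := by
  unfold hermD
  rw [gramD_eq_diagonal, Matrix.diagonal_map (map_zero _)]
  rfl

/-- the two adelic unitary groups `U(J^𝔻)(𝔸)` and `U(diagonal dD)(𝔸)` are the SAME subgroup of `GL_{n+n}(𝔸_L)`.
[cite: GelbartRogawski1991, §3.1 Prop. 3.1.1 p. 455] -/
theorem adelic_hermD_eq :
    UnitaryGroup.adelic (Fp L) L (IsCMField.complexConj L) (n + n) (hermD L e dV hdV dW hdW) =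
      UnitaryGroup.adelic (Fp L) L (IsCMField.complexConj L) (n + n) (Matrix.diagonal (dD L e dV hdV dW hdW)) := by
  rw [hermD_eq_diagonal_dD]

/-! ## 2. Transport `H(𝔸) ≃* U(diagonal dD)(𝔸)` (identity on matrices) -/

/-- **`toDiagA : H(𝔸) ≃* U(diagonal dD)(𝔸_{L⁺})`** — the identity of `GL_{n+n}(𝔸_L)` read between two equal subgroups (`MulEquiv.subgroupCongr`).
[cite: GelbartRogawski1991, §3.1 Prop. 3.1.1 p. 455] -/
def toDiagA : HA L e dV hdV dW hdW ≃* ↥(UnitaryGroup.adelic (Fp L) L (IsCMField.complexConj L) (n + n) (Matrix.diagonal (dD L e dV hdV dW hdW))) :=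
  MulEquiv.subgroupCongr (adelic_hermD_eq L e dV hdV dW hdW)

/-- `toDiagA` is the identity on matrices. [cite: GelbartRogawski1991, §3.1 Prop. 3.1.1 p. 455] -/
@[simp] theorem coe_toDiagA (h : HA L e dV hdV dW hdW) :
    ((toDiagA L e dV hdV dW hdW h : ↥(UnitaryGroup.adelic (Fp L) L (IsCMField.complexConj L) (n + n) (Matrix.diagonal (dD L e dV hdV dW hdW)))) :
        GL (Fin (n + n)) (AdeleRing (𝓞 L) L)) = (h : GL (Fin (n + n)) (AdeleRing (𝓞 L) L)) := by
  rw [toDiagA, MulEquiv.subgroupCongr_apply]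

/-- `toDiagA⁻¹` is the identity on matrices. [cite: GelbartRogawski1991, §3.1 Prop. 3.1.1 p. 455] -/
@[simp] theorem coe_toDiagA_symm (h : ↥(UnitaryGroup.adelic (Fp L) L (IsCMField.complexConj L) (n + n) (Matrix.diagonal (dD L e dV hdV dW hdW)))) :
    (((toDiagA L e dV hdV dW hdW).symm h : HA L e dV hdV dW hdW) : GL (Fin (n + n)) (AdeleRing (𝓞 L) L)) =
      (h : GL (Fin (n + n)) (AdeleRing (𝓞 L) L)) := by
  rw [toDiagA, MulEquiv.subgroupCongr_symm_apply]

/-- `toDiagA` is continuous (subspace topologies of `GL_{n+n}(𝔸_L)`). [cite: GelbartRogawski1991, §3.1 Prop. 3.1.1 p. 455] -/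
theorem continuous_toDiagA : Continuous (toDiagA L e dV hdV dW hdW) := by
  refine continuous_induced_rng.2 ?_
  have hval : (Subtype.val ∘ (toDiagA L e dV hdV dW hdW) :
      HA L e dV hdV dW hdW → GL (Fin (n + n)) (AdeleRing (𝓞 L) L)) = Subtype.val :=
    funext fun x => coe_toDiagA L e dV hdV dW hdW x
  rw [hval]
  exact continuous_subtype_val

/-- `toDiagA⁻¹` is continuous. [cite: GelbartRogawski1991, §3.1 Prop. 3.1.1 p. 455] -/
theorem continuous_toDiagA_symm : Continuous (toDiagA L e dV hdV dW hdW).symm := by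
  refine continuous_induced_rng.2 ?_
  have hval : (Subtype.val ∘ (toDiagA L e dV hdV dW hdW).symm :
      ↥(UnitaryGroup.adelic (Fp L) L (IsCMField.complexConj L) (n + n) (Matrix.diagonal (dD L e dV hdV dW hdW))) →
        GL (Fin (n + n)) (AdeleRing (𝓞 L) L)) = Subtype.val :=
    funext fun x => coe_toDiagA_symm L e dV hdV dW hdW x
  rw [hval]
  exact continuous_subtype_val

/-! ## 3. The doubled theta lift and the theta integral `I(h; Φ)` -/

variable {n'' : ℕ} (e₁ : Fin (n + n) × Fin 1 ≃ Fin n'') (hdV0 : ∀ i, dV i ≠ 0) (hdW0 : ∀ i, dW i ≠ 0)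
  (lam : Literature.NumberTheory.Automorphic.IdeleClassGroup L →ₜ* Circle) (hlam : IsConjugateSymplectic L lam)
  (a' : (↥(maximalRealSubfield L))ˣ)

/-- **The theta lift from the hermitian line `⟨a'⟩` to the DOUBLED group, read on `H(𝔸)`**:
`Θ̃_Φ(f)(h) := ∫_{[U(⟨a'⟩)]} f(q) · θ_Φ((toDiagA h)⁻¹ Γ, q) dμW(q)` with the KERNEL ★ `(lineThetaKernelDatum L (n+n) e₁ dD … lam hlam a' hρ).thetaKer Φ` — the letter's line-theta
machine at rank `N := n + n` and diagonal coefficients `dD`, transported along `J^𝔻 = diagonal dD`; the POINTWISE integral is used instead of ★ `thetaLiftFun`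
because the latter is typed under `[CompactSpace [U(𝔻)]]`, which FAILS for the quasi-split doubled group (same convention `g ↦ Θ_Φ(f)(g⁻¹ Γ)`, same integrand
`f q • θ_Φ(·, q)` as ★ `Weil1964.ThetaKernelDatum.thetaLift`).  `μW` is a (finite, invariant) measure on `[U(⟨a'⟩)]`, `f` a continuous
weight on `[U(⟨a'⟩)]`, `Φ` a Schwartz–Bruhat function on `𝔸_{L⁺}^{n''}`, `n'' = (n+n)·1`. [cite: Liu2021, App. B (B.7) p. 104] [cite: KudlaRallis1994, §1] -/
def doubledLineThetaLift
    (hρ : HasThetaMajorants fun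
      (p : ↥(UnitaryGroup.adelic (Fp L) L (IsCMField.complexConj L) (n + n) (Matrix.diagonal (dD L e dV hdV dW hdW))) ×
        ↥(UnitaryGroup.adelic (Fp L) L (IsCMField.complexConj L) 1 (JW (Fp L) L a')))
      (Φ : piSchwartzBruhat (Fp L) (Fin n'')) =>
        pairRep (Fp L) L (IsCMField.complexConj L) (n + n) 1 e₁ (Matrix.diagonal (dD L e dV hdV dW hdW)) (JW (Fp L) L a')
          (chiSplittingLine L e₁ (dD L e dV hdV dW hdW) (dD_conj L e dV hdV dW hdW) (dD_ne_zero L e dV hdV dW hdW hdV0 hdW0)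
            (toHeckeCharacter L lam) (isUnitary_toHeckeCharacter L lam)
            ((isOscillatorChar_toHeckeCharacter_iff lam).mpr hlam) (TW (Fp L) a')
            (isUnit_det_TW (Fp L) a') (JW (Fp L) L a') (JW_eq (Fp L) L a'))
          p Φ)
    [MeasurableSpace (↥(UnitaryGroup.adelic (Fp L) L (IsCMField.complexConj L) 1 (JW (Fp L) L a')) ⧸
      (UnitaryGroup.toAdelic (Fp L) L (IsCMField.complexConj L) 1 (JW (Fp L) L a')).range)]
    (μW : Measure (↥(UnitaryGroup.adelic (Fp L) L (IsCMField.complexConj L) 1 (JW (Fp L) L a')) ⧸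
      (UnitaryGroup.toAdelic (Fp L) L (IsCMField.complexConj L) 1 (JW (Fp L) L a')).range))
    (Φ : piSchwartzBruhat (Fp L) (Fin n''))
    (f : C(↥(UnitaryGroup.adelic (Fp L) L (IsCMField.complexConj L) 1 (JW (Fp L) L a')) ⧸
      (UnitaryGroup.toAdelic (Fp L) L (IsCMField.complexConj L) 1 (JW (Fp L) L a')).range, ℂ)) :
    HA L e dV hdV dW hdW → ℂ :=
  fun h => ∫ q, f q * (lineThetaKernelDatum L (n + n) e₁ (dD L e dV hdV dW hdW) (dD_conj L e dV hdV dW hdW)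
      (dD_ne_zero L e dV hdV dW hdW hdV0 hdW0) lam hlam a' hρ).thetaKer Φ
        (QuotientGroup.mk (toDiagA L e dV hdV dW hdW h)⁻¹, q) ∂μW

/-- **The doubled THETA INTEGRAL `I(h; Φ) = ∫_{[U(⟨a'⟩)]} θ_Φ(h, w) dμW(w)`** — the theta lift of the constant weight `1`
(absolutely convergent: `[U(⟨a'⟩)]` is compact, the line being anisotropic).  This is the function on `H(𝔸)` whose multiple the residue at the top pole
of the Siegel Eisenstein series equals in the regularised Siegel–Weil first-term identity (socket #42), and whose value at `ι(g₁,g₂)` undoubles (socket #44).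
[cite: Liu2021, App. B (B.7), Prop. B.8 p. 104] [cite: KudlaRallis1994, §6] -/
def doubledLineThetaIntegral
    (hρ : HasThetaMajorants fun
      (p : ↥(UnitaryGroup.adelic (Fp L) L (IsCMField.complexConj L) (n + n) (Matrix.diagonal (dD L e dV hdV dW hdW))) ×
        ↥(UnitaryGroup.adelic (Fp L) L (IsCMField.complexConj L) 1 (JW (Fp L) L a')))
      (Φ : piSchwartzBruhat (Fp L) (Fin n'')) =>
        pairRep (Fp L) L (IsCMField.complexConj L) (n + n) 1 e₁ (Matrix.diagonal (dD L e dV hdV dW hdW)) (JW (Fp L) L a')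
          (chiSplittingLine L e₁ (dD L e dV hdV dW hdW) (dD_conj L e dV hdV dW hdW) (dD_ne_zero L e dV hdV dW hdW hdV0 hdW0)
            (toHeckeCharacter L lam) (isUnitary_toHeckeCharacter L lam)
            ((isOscillatorChar_toHeckeCharacter_iff lam).mpr hlam) (TW (Fp L) a')
            (isUnit_det_TW (Fp L) a') (JW (Fp L) L a') (JW_eq (Fp L) L a'))
          p Φ)
    [MeasurableSpace (↥(UnitaryGroup.adelic (Fp L) L (IsCMField.complexConj L) 1 (JW (Fp L) L a')) ⧸
      (UnitaryGroup.toAdelic (Fp L) L (IsCMField.complexConj L) 1 (JW (Fp L) L a')).range)]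
    (μW : Measure (↥(UnitaryGroup.adelic (Fp L) L (IsCMField.complexConj L) 1 (JW (Fp L) L a')) ⧸
      (UnitaryGroup.toAdelic (Fp L) L (IsCMField.complexConj L) 1 (JW (Fp L) L a')).range))
    (Φ : piSchwartzBruhat (Fp L) (Fin n'')) : HA L e dV hdV dW hdW → ℂ :=
  doubledLineThetaLift L e dV hdV dW hdW e₁ hdV0 hdW0 lam hlam a' hρ μW Φ 1

/-- `I(·; Φ)` IS the theta lift of the constant weight `1` (definitional). [cite: Liu2021, App. B (B.7) p. 104] -/
theorem doubledLineThetaIntegral_eq_lift (hρ)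
    [MeasurableSpace (↥(UnitaryGroup.adelic (Fp L) L (IsCMField.complexConj L) 1 (JW (Fp L) L a')) ⧸
      (UnitaryGroup.toAdelic (Fp L) L (IsCMField.complexConj L) 1 (JW (Fp L) L a')).range)]
    (μW) (Φ : piSchwartzBruhat (Fp L) (Fin n'')) :
    doubledLineThetaIntegral L e dV hdV dW hdW e₁ hdV0 hdW0 lam hlam a' hρ μW Φ =
      doubledLineThetaLift L e dV hdV dW hdW e₁ hdV0 hdW0 lam hlam a' hρ μW Φ 1 := rfl

/-- `Θ̃_Φ(f)` on points: the integral of the letter's KERNEL at the transported matrix (definitional). [cite: Liu2021, App. B (B.7) p. 104] -/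
theorem doubledLineThetaLift_apply (hρ)
    [MeasurableSpace (↥(UnitaryGroup.adelic (Fp L) L (IsCMField.complexConj L) 1 (JW (Fp L) L a')) ⧸
      (UnitaryGroup.toAdelic (Fp L) L (IsCMField.complexConj L) 1 (JW (Fp L) L a')).range)]
    (μW) (Φ : piSchwartzBruhat (Fp L) (Fin n'')) (f) (h : HA L e dV hdV dW hdW) :
    doubledLineThetaLift L e dV hdV dW hdW e₁ hdV0 hdW0 lam hlam a' hρ μW Φ f h =
      ∫ q, f q * (lineThetaKernelDatum L (n + n) e₁ (dD L e dV hdV dW hdW) (dD_conj L e dV hdV dW hdW)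
        (dD_ne_zero L e dV hdV dW hdW hdV0 hdW0) lam hlam a' hρ).thetaKer Φ
          (QuotientGroup.mk (toDiagA L e dV hdV dW hdW h)⁻¹, q) ∂μW := rfl

end Literature.NumberTheory.K2Lit.DoubledLineTheta

end
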